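import Summits.ResolutionOfSingularities.ResolutionOfSingularities.Theorems.FrobeniusClosingPatchingRelPerfectCentreSeqExtendOpen
import Literature.AlgebraicGeometry.Resolution.RegularSubschemeLocallyIrreducible
import HarnessLib

/-!
# Crux `PatchingRelPerfect` (stmt-ResolutionOfSingularities-16161), chain W5.2 — F7(β) (β-AX) X3 C-I (G2) engine:
# THE MAXIMAL LEGAL EXTENSION OF A STRATUM PIECE IS A REGULAR CLOSED CENTRE (brick (b1) `ClopenCentre`)

[OURS · L1 W5.2 · res-D-pv-046 ENGINE NOTE 4 2026-08-27T21:48:11Z, CLAIM 1 «KEY LEMMA (no splitting)»; line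
`Cruxes/PatchingRelPerfect/Lines/closed_point_slice.lean`.]  Replaces the role of NO printed item; NOT a statement of the manuscript
under review; fact-free; def-free; any locally Noetherian scheme.  AI-written; AI review is weaker than expert review.

THE SETTING (Bierstone–Milman, *Desingularization of toric and binomial varieties*, proof of Thm. 8.5 / Lemma 8.7: the chart-by-chart
resolution, where a centre found on one chart is extended to the whole variety as an ORBIT CLOSURE).  In the (G2) engine the analogue of
an orbit closure is a stratum `V = V(J)` of ONE globally snc letter list — a REGULAR closed subscheme of the current top `T` — and the
centre found on the active presented piece is the stratum piece `V ∩ D_act`, legal there (`⊆ S := Sing(K, m)`).  Its MAXIMAL LEGAL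
EXTENSION is `V ∩ U` for the open `U :=` union of the pieces on which the whole stratum piece is legal.  The finitely many presented
pieces `D_i` cover `S`, and on a piece where `J` is NOT legal the legal part `V ∩ D_i ∩ S` is nowhere dense in `V ∩ D_i`
(it is a finite union of proper sub-strata).  THIS FILE: under exactly these hypotheses

* `closure_inter_coe_eq_empty` — the closure of `V ∩ U` misses every «bad» piece (regular ⇒ locally irreducible, tree
  `exists_opens_isIrreducible_support_inter`, Stacks 0357; a non-empty relatively open subset of an irreducible set is dense);
* `isClosed_support_inter_coe` — hence `V ∩ U` is CLOSED in `T` (its closure lies in `S ⊆ ⋃ D_i`; good pieces lie in `U`, bad pieces are missed);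
* `exists_clopenCentre` — the centre `Z := (V|_U).map U.ι` (Mathlib `IdealSheafData.map`, tree `CentreSeqExtend` §1) is REGULAR, has support
  `V ∩ U ⊆ S`, restricts to `V` on `U` (so on every good piece) and to `𝒪` on every bad piece — NO PIECE IS SPLIT.

## References (for the mathematics; nothing here is a statement of the manuscript under review)
* E. Bierstone, P. Milman, *Desingularization of toric and binomial varieties*, J. Algebraic Geom. 15 (2006), proof of Thm. 8.5 and
  Lemma 8.7. [BierstoneMilman2006]
* The Stacks Project, Tag 0357 (regular local ring ⇒ locally irreducible). [StacksProject]
* U. Görtz, T. Wedhorn, *Algebraic Geometry I*, 2nd ed. (2020), Prop. 13.91 (1). [GortzWedhorn2020]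
-/

-- `Summit.<Summit>.<Sub>.Theorems` with `Sub = Summit` (single-conjunct summit, D-0017)
set_option linter.dupNamespace false

noncomputable section

open CategoryTheory CategoryTheory.Limits AlgebraicGeometry TopologicalSpace
open Literature.AlgebraicGeometry.Resolution

namespace Summit.ResolutionOfSingularities.ResolutionOfSingularities.Theorems

namespace ClopenCentre

universe u v

variable {T : Scheme.{u}} [IsLocallyNoetherian T]

/-! ## §1 The relatively open legal part of a regular stratum is closed -/

/-- **The closure of the legal part `V ∩ U` of a regular closed subscheme `V` misses every bad piece.**  Here `S` is closed, `V ∩ U ⊆ S`,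
and the piece `D` is «bad»: no non-empty relatively open subset `V ∩ W` (`W ⊆ D` open) lies in `S`.  Proof: at `y ∈ cl(V ∩ U) ∩ D`
the support of `V` is irreducible on some open `W₀ ∋ y` (Stacks 0357); `V ∩ U` meets `W := W₀ ∩ D` in a non-empty relatively open
subset of the irreducible `V ∩ W₀`, hence `V ∩ W ⊆ cl(V ∩ U) ⊆ S` — contradiction. [cite: StacksProject, Tag 0357] -/
theorem closure_inter_coe_eq_empty (V : T.IdealSheafData) (hV : Scheme.IsRegular V.subscheme) {S : Set T} (hS : IsClosed S)
    (U : T.Opens) (hUS : (V.support : Set T) ∩ U ⊆ S) (D : T.Opens)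
    (hbad : ∀ W : T.Opens, W ≤ D → ((V.support : Set T) ∩ W).Nonempty → ¬ ((V.support : Set T) ∩ W ⊆ S)) :
    closure ((V.support : Set T) ∩ U) ∩ (D : Set T) = ∅ := by
  refine Set.eq_empty_iff_forall_notMem.mpr fun y ⟨hycl, hyD⟩ => ?_
  have hclS : closure ((V.support : Set T) ∩ U) ⊆ S := closure_minimal hUS hS
  have hclV : closure ((V.support : Set T) ∩ U) ⊆ (V.support : Set T) := closure_minimal Set.inter_subset_left V.support.isClosed
  have hyV : y ∈ (V.support : Set T) := hclV hycl
  obtain ⟨W₀, hyW₀, hirr⟩ := exists_opens_isIrreducible_support_inter V hV hyV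
  refine hbad (W₀ ⊓ D) inf_le_right ⟨y, hyV, hyW₀, hyD⟩ fun a ⟨haV, haW₀, haD⟩ => hclS ?_
  -- `a ∈ cl(V ∩ U)`: every open `v ∋ a` meets `V ∩ U`, by irreducibility of `V ∩ W₀`
  rw [mem_closure_iff]
  intro v hv hav
  obtain ⟨o, ⟨hoW₀, hoD⟩, hoV, hoU⟩ := mem_closure_iff.mp hycl _ (W₀ ⊓ D).isOpen ⟨hyW₀, hyD⟩
  obtain ⟨b, ⟨hbV, -⟩, ⟨hbU, -⟩, hbv, -⟩ := hirr.isPreirreducible ((U : Set T) ∩ (W₀ ⊓ D : T.Opens)) (v ∩ (W₀ ⊓ D : T.Opens))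
    (U.isOpen.inter (W₀ ⊓ D).isOpen) (hv.inter (W₀ ⊓ D).isOpen) ⟨o, ⟨hoV, hoW₀⟩, hoU, hoW₀, hoD⟩ ⟨a, ⟨haV, haW₀⟩, hav, haW₀, haD⟩
  exact ⟨b, hbv, hbV, hbU⟩

/-- **The legal part `V ∩ U` is CLOSED**, when the closed set `S ⊇ V ∩ U` is covered by pieces each of which is either inside `U` («good»)
or bad in the sense of `closure_inter_coe_eq_empty`. [cite: BierstoneMilman2006, proof of Thm. 8.5] -/
theorem isClosed_support_inter_coe (V : T.IdealSheafData) (hV : Scheme.IsRegular V.subscheme) {S : Set T} (hS : IsClosed S)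
    (U : T.Opens) (hUS : (V.support : Set T) ∩ U ⊆ S) {ι : Type v} (D : ι → T.Opens) (hcov : S ⊆ ⋃ i, (D i : Set T))
    (hD : ∀ i, D i ≤ U ∨ ∀ W : T.Opens, W ≤ D i → ((V.support : Set T) ∩ W).Nonempty → ¬ ((V.support : Set T) ∩ W ⊆ S)) :
    IsClosed ((V.support : Set T) ∩ U) := by
  refine isClosed_of_closure_subset fun y hycl => ?_
  have hyS : y ∈ S := closure_minimal hUS hS hycl
  have hyV : y ∈ (V.support : Set T) := closure_minimal Set.inter_subset_left V.support.isClosed hycl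
  obtain ⟨i, hyi⟩ := Set.mem_iUnion.mp (hcov hyS)
  rcases hD i with h | h
  · exact ⟨hyV, h hyi⟩
  · have he := closure_inter_coe_eq_empty V hV hS U hUS (D i) h
    exact absurd (Set.mem_inter hycl hyi) (he ▸ Set.notMem_empty y)

/-! ## §2 The centre -/

omit [IsLocallyNoetherian T] in
/-- **A regular closed subscheme restricts to a regular closed subscheme on an open** (`V(C|_U) ≅ U ×_T V(C)` is an open subscheme of
`V(C)`). [folklore] -/
theorem isRegular_subscheme_comap_ι (V : T.IdealSheafData) (hV : Scheme.IsRegular V.subscheme) (U : T.Opens) :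
    Scheme.IsRegular (V.comap U.ι).subscheme :=
  Scheme.IsRegular.of_isOpenImmersion ((V.comapIso U.ι).hom ≫ pullback.snd U.ι V.subschemeι) hV

/-- **THE MAXIMAL LEGAL EXTENSION IS A REGULAR CLOSED CENTRE THAT SPLITS NO PIECE.**  Let `V` be a regular closed subscheme of a locally
Noetherian `T` (a stratum of the global snc letters), `S ⊆ T` closed (`Sing(K, m)`), `U` open with `V ∩ U ⊆ S` (the union of the pieces on
which the stratum is legal), and `D_i` opens covering `S`, each inside `U` or bad (`V ∩ D_i ∩ S` contains no non-empty relatively open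
`V ∩ W`).  Then the centre `Z := (V|_U)𝒪_T` (push-forward along `U ↪ T`) is REGULAR, `supp Z = V ∩ U ⊆ S`, `Z|_U = V|_U` (so `Z = V` on every
piece inside `U`), and `Z|_{D_i} = 𝒪` on every bad piece. [cite: BierstoneMilman2006, proof of Thm. 8.5, Lemma 8.7]
[cite: GortzWedhorn2020, Prop. 13.91 (1)] -/
theorem exists_clopenCentre (V : T.IdealSheafData) (hV : Scheme.IsRegular V.subscheme) {S : Set T} (hS : IsClosed S)
    (U : T.Opens) (hUS : (V.support : Set T) ∩ U ⊆ S) {ι : Type v} (D : ι → T.Opens) (hcov : S ⊆ ⋃ i, (D i : Set T))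
    (hD : ∀ i, D i ≤ U ∨ ∀ W : T.Opens, W ≤ D i → ((V.support : Set T) ∩ W).Nonempty → ¬ ((V.support : Set T) ∩ W ⊆ S)) :
    ∃ Z : T.IdealSheafData, Scheme.IsRegular Z.subscheme ∧ (Z.support : Set T) = (V.support : Set T) ∩ U ∧
      (Z.support : Set T) ⊆ S ∧ Z.comap U.ι = V.comap U.ι ∧
      (∀ i, D i ≤ U → Z.comap (D i).ι = V.comap (D i).ι) ∧
      (∀ i, (∀ W : T.Opens, W ≤ D i → ((V.support : Set T) ∩ W).Nonempty → ¬ ((V.support : Set T) ∩ W ⊆ S)) → Z.comap (D i).ι = ⊤) := by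
  have hcl : IsClosed ((V.support : Set T) ∩ U) := isClosed_support_inter_coe V hV hS U hUS D hcov hD
  -- the restricted stratum and its push-forward
  set C : (U : Scheme.{u}).IdealSheafData := V.comap U.ι with hC
  have hCsupp : (C.support : Set (U : Scheme.{u})) = U.ι.base ⁻¹' (V.support : Set T) := by
    rw [hC, Scheme.IdealSheafData.support_comap]; rfl
  have himage : U.ι.base '' (C.support : Set (U : Scheme.{u})) = (V.support : Set T) ∩ U := by
    rw [hCsupp, Set.image_preimage_eq_inter_range, Scheme.Opens.range_ι]
  set Z : T.IdealSheafData := C.map U.ι with hZ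
  have hZsupp : (Z.support : Set T) = (V.support : Set T) ∩ U := by
    rw [hZ, Scheme.IdealSheafData.support_map, Closeds.coe_closure, himage, hcl.closure_eq]
  have hZU : Z.comap U.ι = V.comap U.ι := CentreSeqExtend.comap_map_of_isOpenImmersion C U.ι
  refine ⟨Z, ?_, hZsupp, hZsupp ▸ hUS, hZU, fun i hi => ?_, fun i hi => ?_⟩
  · -- regular: `V(Z) ≅ V(C)` stalkwise, `C` cosupported over the closed `V ∩ U ⊆ U`
    refine CentreSeqExtend.isRegular_subscheme_map C U.ι hcl ?_ ?_ (isRegular_subscheme_comap_ι V hV U)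
    · intro x hx
      exact ⟨⟨x, hx.2⟩, rfl⟩
    · intro u hu
      rw [hCsupp] at hu
      exact ⟨hu, u.2⟩
  · -- a piece inside `U`
    rw [← Scheme.homOfLE_ι T hi, Scheme.IdealSheafData.comap_comp, hZU, ← Scheme.IdealSheafData.comap_comp]
  · -- a bad piece: empty support
    rw [← Scheme.IdealSheafData.support_eq_bot_iff]
    apply le_bot_iff.mp
    intro x hx
    rw [Scheme.IdealSheafData.support_comap] at hx
    have hx' : (D i).ι.base x ∈ (Z.support : Set T) := hx
    rw [hZsupp, ← hcl.closure_eq] at hx'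
    have he := closure_inter_coe_eq_empty V hV hS U hUS (D i) hi
    have hxD : (D i).ι.base x ∈ (D i : Set T) := by
      rw [Scheme.Opens.ι_apply]
      exact x.2
    exact (he ▸ Set.notMem_empty ((D i).ι.base x)) ⟨hx', hxD⟩

/-! ## §3 The same, with the stratum regular ON THE PIECES only

In the (G2) engine the letters are snc near `cosupp K` only, so the global stratum `V` is known to be regular on the presented pieces, not on
all of `T`.  The arguments of §1–§2 localise verbatim. -/

/-- Regularity of `V(K)` at a point is read on any open through it: for an open immersion `f : X' ⟶ X` the local ring of `V(K|_{X'})` at `x'`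
is that of `V(K)` at `f x'`. [folklore] -/
theorem isRegularLocalRing_quotient_stalkIdeal_comap_iff {X X' : Scheme.{u}} (f : X' ⟶ X) [IsOpenImmersion f] (K : X.IdealSheafData)
    (x' : X') : IsRegularLocalRing (X'.presheaf.stalk x' ⧸ stalkIdeal (K.comap f) x') ↔
      IsRegularLocalRing (X.presheaf.stalk (f x') ⧸ stalkIdeal K (f x')) := by
  let e : X.presheaf.stalk (f x') ≃+* X'.presheaf.stalk x' := (asIso (f.stalkMap x')).commRingCatIsoToRingEquiv
  have h : stalkIdeal (K.comap f) x' = (stalkIdeal K (f x')).map (e : _ →+* _) := stalkIdeal_comap_eq_map_stalkMap f K x'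
  let q : (X.presheaf.stalk (f x') ⧸ stalkIdeal K (f x')) ≃+* (X'.presheaf.stalk x' ⧸ stalkIdeal (K.comap f) x') :=
    Ideal.quotientEquiv _ _ e h
  exact ⟨fun H => IsRegularLocalRing.of_ringEquiv q.symm, fun H => IsRegularLocalRing.of_ringEquiv q⟩

/-- **`V(C|_U)` is regular if `U` is covered by opens `D_i ⊆ U` on which `V(C|_{D_i})` is regular** (regularity of a closed subscheme is
stalk-local). [folklore] -/
theorem isRegular_subscheme_comap_of_cover (V : T.IdealSheafData) (U : T.Opens) {ι : Type v} (D : ι → T.Opens)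
    (hUcov : (U : Set T) ⊆ ⋃ (i) (_ : D i ≤ U), (D i : Set T)) (hV : ∀ i, D i ≤ U → Scheme.IsRegular (V.comap (D i).ι).subscheme) :
    Scheme.IsRegular (V.comap U.ι).subscheme := by
  rw [Scheme.isRegular_subscheme_iff]
  intro x hx
  obtain ⟨i, hi⟩ := Set.mem_iUnion.mp (hUcov x.2)
  obtain ⟨hiU, hxi⟩ := Set.mem_iUnion.mp hi
  have hxV : x.1 ∈ (V.support : Set T) := by
    have h : x ∈ ((V.comap U.ι).support : Set (U : Scheme.{u})) := hx
    rw [Scheme.IdealSheafData.support_comap] at h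
    exact h
  have hreg := (Scheme.isRegular_subscheme_iff _).mp (hV i hiU) ⟨x.1, hxi⟩ (by
    change (⟨x.1, hxi⟩ : (D i : Scheme.{u})) ∈ (((V.comap (D i).ι).support : Set (D i : Scheme.{u})))
    rw [Scheme.IdealSheafData.support_comap]
    exact hxV)
  rw [isRegularLocalRing_quotient_stalkIdeal_comap_iff] at hreg ⊢
  exact hreg

/-- `closure_inter_coe_eq_empty` with `V` regular ON THE BAD PIECE only. [cite: StacksProject, Tag 0357] -/
theorem closure_inter_coe_eq_empty_of_piece (V : T.IdealSheafData) {S : Set T} (hS : IsClosed S)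
    (U : T.Opens) (hUS : (V.support : Set T) ∩ U ⊆ S) (D : T.Opens) (hVD : Scheme.IsRegular (V.comap D.ι).subscheme)
    (hbad : ∀ W : T.Opens, W ≤ D → ((V.support : Set T) ∩ W).Nonempty → ¬ ((V.support : Set T) ∩ W ⊆ S)) :
    closure ((V.support : Set T) ∩ U) ∩ (D : Set T) = ∅ := by
  refine Set.eq_empty_iff_forall_notMem.mpr fun y ⟨hycl, hyD⟩ => ?_
  have hclS : closure ((V.support : Set T) ∩ U) ⊆ S := closure_minimal hUS hS
  have hclV : closure ((V.support : Set T) ∩ U) ⊆ (V.support : Set T) := closure_minimal Set.inter_subset_left V.support.isClosed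
  have hyV : y ∈ (V.support : Set T) := hclV hycl
  -- local irreducibility of `V ∩ D` at `y`, read on the piece and pushed to `T`
  have hsuppD : (((V.comap D.ι).support : Set (D : Scheme.{u}))) = Subtype.val ⁻¹' (V.support : Set T) := by
    rw [Scheme.IdealSheafData.support_comap]; rfl
  have hyVD : (⟨y, hyD⟩ : (D : Scheme.{u})) ∈ ((V.comap D.ι).support : Set (D : Scheme.{u})) := by
    rw [hsuppD]; exact hyV
  obtain ⟨W₀', hyW₀', hirr'⟩ := exists_opens_isIrreducible_support_inter (V.comap D.ι) hVD hyVD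
  set W₀ : Set T := Subtype.val '' (W₀' : Set (D : Scheme.{u})) with hW₀
  have hW₀open : IsOpen W₀ := D.isOpen.isOpenMap_subtype_val _ W₀'.isOpen
  have hW₀D : W₀ ⊆ (D : Set T) := by
    rintro _ ⟨z, -, rfl⟩; exact z.2
  have himg : Subtype.val '' ((((V.comap D.ι).support : Set (D : Scheme.{u}))) ∩ (W₀' : Set (D : Scheme.{u}))) =
      (V.support : Set T) ∩ W₀ := by
    rw [hsuppD]
    ext z
    constructor
    · rintro ⟨z', ⟨hz'V, hz'W⟩, rfl⟩
      exact ⟨hz'V, z', hz'W, rfl⟩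
    · rintro ⟨hzV, z', hz'W, rfl⟩
      exact ⟨z', ⟨hzV, hz'W⟩, rfl⟩
  have hirr : IsIrreducible ((V.support : Set T) ∩ W₀) :=
    himg ▸ hirr'.image _ continuous_subtype_val.continuousOn
  have hyW₀ : y ∈ W₀ := ⟨⟨y, hyD⟩, hyW₀', rfl⟩
  refine hbad ⟨W₀, hW₀open⟩ (fun z hz => hW₀D hz) ⟨y, hyV, hyW₀⟩ fun a ⟨haV, haW₀⟩ => hclS ?_
  -- `a ∈ cl(V ∩ U)`: every open `v ∋ a` meets `V ∩ U`, by irreducibility of `V ∩ W₀`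
  rw [mem_closure_iff]
  intro v hv hav
  obtain ⟨o, hoW₀, hoV, hoU⟩ := mem_closure_iff.mp hycl _ hW₀open hyW₀
  obtain ⟨b, ⟨hbV, -⟩, ⟨hbU, -⟩, hbv, -⟩ := hirr.isPreirreducible ((U : Set T) ∩ W₀) (v ∩ W₀)
    (U.isOpen.inter hW₀open) (hv.inter hW₀open) ⟨o, ⟨hoV, hoW₀⟩, hoU, hoW₀⟩ ⟨a, ⟨haV, haW₀⟩, hav, haW₀⟩
  exact ⟨b, hbv, hbV, hbU⟩

/-- `isClosed_support_inter_coe` with `V` regular ON THE PIECES only. [cite: BierstoneMilman2006, proof of Thm. 8.5] -/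
theorem isClosed_support_inter_coe_of_pieces (V : T.IdealSheafData) {S : Set T} (hS : IsClosed S)
    (U : T.Opens) (hUS : (V.support : Set T) ∩ U ⊆ S) {ι : Type v} (D : ι → T.Opens) (hcov : S ⊆ ⋃ i, (D i : Set T))
    (hV : ∀ i, Scheme.IsRegular (V.comap (D i).ι).subscheme)
    (hD : ∀ i, D i ≤ U ∨ ∀ W : T.Opens, W ≤ D i → ((V.support : Set T) ∩ W).Nonempty → ¬ ((V.support : Set T) ∩ W ⊆ S)) :
    IsClosed ((V.support : Set T) ∩ U) := by
  refine isClosed_of_closure_subset fun y hycl => ?_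
  have hyS : y ∈ S := closure_minimal hUS hS hycl
  have hyV : y ∈ (V.support : Set T) := closure_minimal Set.inter_subset_left V.support.isClosed hycl
  obtain ⟨i, hyi⟩ := Set.mem_iUnion.mp (hcov hyS)
  rcases hD i with h | h
  · exact ⟨hyV, h hyi⟩
  · have he := closure_inter_coe_eq_empty_of_piece V hS U hUS (D i) (hV i) h
    exact absurd (Set.mem_inter hycl hyi) (he ▸ Set.notMem_empty y)

/-- **THE MAXIMAL LEGAL EXTENSION, WITH THE STRATUM REGULAR ON THE PIECES ONLY** (the form the (G2) engine consumes: the letters are snc near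
`cosupp K`, i.e. on the presented pieces).  As `exists_clopenCentre`, with `V(V|_{D_i})` regular for every piece and `U` covered by the pieces
inside it. [cite: BierstoneMilman2006, proof of Thm. 8.5, Lemma 8.7] [cite: GortzWedhorn2020, Prop. 13.91 (1)] -/
theorem exists_clopenCentre_of_pieces (V : T.IdealSheafData) {S : Set T} (hS : IsClosed S)
    (U : T.Opens) (hUS : (V.support : Set T) ∩ U ⊆ S) {ι : Type v} (D : ι → T.Opens) (hcov : S ⊆ ⋃ i, (D i : Set T))
    (hUcov : (U : Set T) ⊆ ⋃ (i) (_ : D i ≤ U), (D i : Set T)) (hV : ∀ i, Scheme.IsRegular (V.comap (D i).ι).subscheme)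
    (hD : ∀ i, D i ≤ U ∨ ∀ W : T.Opens, W ≤ D i → ((V.support : Set T) ∩ W).Nonempty → ¬ ((V.support : Set T) ∩ W ⊆ S)) :
    ∃ Z : T.IdealSheafData, Scheme.IsRegular Z.subscheme ∧ (Z.support : Set T) = (V.support : Set T) ∩ U ∧
      (Z.support : Set T) ⊆ S ∧ Z.comap U.ι = V.comap U.ι ∧
      (∀ i, D i ≤ U → Z.comap (D i).ι = V.comap (D i).ι) ∧
      (∀ i, (∀ W : T.Opens, W ≤ D i → ((V.support : Set T) ∩ W).Nonempty → ¬ ((V.support : Set T) ∩ W ⊆ S)) → Z.comap (D i).ι = ⊤) := by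
  have hcl : IsClosed ((V.support : Set T) ∩ U) := isClosed_support_inter_coe_of_pieces V hS U hUS D hcov hV hD
  -- the restricted stratum and its push-forward
  set C : (U : Scheme.{u}).IdealSheafData := V.comap U.ι with hC
  have hCsupp : (C.support : Set (U : Scheme.{u})) = U.ι.base ⁻¹' (V.support : Set T) := by
    rw [hC, Scheme.IdealSheafData.support_comap]; rfl
  have himage : U.ι.base '' (C.support : Set (U : Scheme.{u})) = (V.support : Set T) ∩ U := by
    rw [hCsupp, Set.image_preimage_eq_inter_range, Scheme.Opens.range_ι]
  set Z : T.IdealSheafData := C.map U.ι with hZ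
  have hZsupp : (Z.support : Set T) = (V.support : Set T) ∩ U := by
    rw [hZ, Scheme.IdealSheafData.support_map, Closeds.coe_closure, himage, hcl.closure_eq]
  have hZU : Z.comap U.ι = V.comap U.ι := CentreSeqExtend.comap_map_of_isOpenImmersion C U.ι
  refine ⟨Z, ?_, hZsupp, hZsupp ▸ hUS, hZU, fun i hi => ?_, fun i hi => ?_⟩
  · refine CentreSeqExtend.isRegular_subscheme_map C U.ι hcl ?_ ?_
      (isRegular_subscheme_comap_of_cover V U D hUcov fun i hi => hV i)
    · intro x hx
      exact ⟨⟨x, hx.2⟩, rfl⟩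
    · intro u hu
      rw [hCsupp] at hu
      exact ⟨hu, u.2⟩
  · rw [← Scheme.homOfLE_ι T hi, Scheme.IdealSheafData.comap_comp, hZU, ← Scheme.IdealSheafData.comap_comp]
  · rw [← Scheme.IdealSheafData.support_eq_bot_iff]
    apply le_bot_iff.mp
    intro x hx
    rw [Scheme.IdealSheafData.support_comap] at hx
    have hx' : (D i).ι.base x ∈ (Z.support : Set T) := hx
    rw [hZsupp, ← hcl.closure_eq] at hx'
    have he := closure_inter_coe_eq_empty_of_piece V hS U hUS (D i) (hV i) hi
    have hxD : (D i).ι.base x ∈ (D i : Set T) := by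
      rw [Scheme.Opens.ι_apply]
      exact x.2
    exact (he ▸ Set.notMem_empty ((D i).ι.base x)) ⟨hx', hxD⟩

end ClopenCentre

end Summit.ResolutionOfSingularities.ResolutionOfSingularities.Theorems

end
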